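import Summits.PneNP.PneNP.Theorems.SymmetryBudgetNoHiddenOrderLexMinSocket

/-!
# `NoHiddenOrder` (stmt-PneNP-14781): reading the output GRAPH off a canonical copy of the window (the `sound` field of `GraphProgram`)

Route `PneNP/SymmetryBudget`; (R2c) support, function level. A window canoniser (e.g. the certified-label scheme over the Corneil–Goldberg process:
root value `encOf (Gr x) col₀ l`, `l` an enumeration of the window `W`) ends with, for each ROW `k < g = |W|`, the colour `rc k = col₀ (l k)` and the
adjacency bits `rb k k' = [l k ~ l k']` of an UNKNOWN enumeration `l` of `W` — unknown to the circuit, which only holds `rc`, `rb` as wires. This file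
defines the output matrix a symmetric circuit can form from these wires and the input, WITHOUT knowing `l`:

* window × window entries: the bits `rb` at the ranks of the two window indices (`wpos`: the `k`-th smallest window index plays row `k`);
* window × ordered entries: "some window vertex of colour `rc k` is adjacent to the ordered vertex" — well defined because `col₀` refines the
  signature colouring (hypothesis `hsig`: equal `col₀` ⇒ equal adjacency to every ordered vertex), and symmetric (an OR over the window);
* ordered × ordered entries: the input graph itself;
(`outM`), and proves **`outM_sound`**: its graph is the graph of the `Bud`-relabelling `ρ` of the input that sends the `k`-th window index to `l k`
and fixes the ordered part (`ρ ∈ pointStabiliserBudget m ⌊log₂ m⌋`); `outM_sound_matrix` is the same in the matrix form of `GraphProgram.sound`.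
-/

set_option linter.dupNamespace false -- `Summit.PneNP.PneNP.…` (D-0017 single-conjunct layout)

namespace Summit.PneNP.PneNP.Theorems

open Finset Literature.Computability.Complexity
open Summit.PneNP.PneNP.Theses.SymmetryBudget

namespace GraphReadout

variable {m g : ℕ} (W : Finset (Fin m))

/-! ### Ranks of window indices -/

/-- The RANK of an index among the window indices: the number of smaller window indices. [folklore] -/
def wrank (i : Fin m) : ℕ := (W.filter fun w => w < i).card

/-- The rank of a window index is below `|W|`. [folklore] -/
theorem wrank_lt {i : Fin m} (hi : i ∈ W) : wrank W i < W.card :=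
  card_lt_card ((filter_ssubset).2 ⟨i, hi, lt_irrefl i⟩)

/-- Ranks of window indices are injective. [folklore] -/
theorem wrank_injOn {i j : Fin m} (hi : i ∈ W) (hj : j ∈ W) (h : wrank W i = wrank W j) : i = j := by
  by_contra hne
  wlog hlt : i < j generalizing i j
  · exact this hj hi h.symm (Ne.symm hne) (lt_of_le_of_ne (not_lt.1 hlt) (Ne.symm hne))
  have hss : (W.filter fun w => w < i) ⊂ W.filter fun w => w < j := by
    rw [Finset.ssubset_iff_of_subset (fun w hw => by rw [mem_filter] at hw ⊢; exact ⟨hw.1, hw.2.trans hlt⟩)]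
    exact ⟨i, mem_filter.2 ⟨hi, hlt⟩, fun h' => lt_irrefl i (mem_filter.1 h').2⟩
  exact absurd h (card_lt_card hss).ne

variable (hg : W.card = g)

/-- The ROW played by a window index: its rank, as an element of `Fin g`. [folklore] -/
def wpos (i : Fin m) (hi : i ∈ W) : Fin g := ⟨wrank W i, hg ▸ wrank_lt W hi⟩

/-! ### The output matrix -/

variable (G : SimpleGraph (Fin m)) [DecidableRel G.Adj] (col₀ : Fin m → ℕ) (rc : Fin g → ℕ) (rb : Fin g → Fin g → Bool)

/-- **The OUTPUT MATRIX read off the row colours `rc` and row bits `rb` of a canonical copy of the window**: window × window from the bits at the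
ranks; window × ordered by "a window vertex of that row's colour is adjacent to the ordered vertex"; ordered × ordered from the input. [folklore] -/
def outM (q : Fin m × Fin m) : Bool :=
  if hi : q.1 ∈ W then
    if hj : q.2 ∈ W then rb (wpos W hg q.1 hi) (wpos W hg q.2 hj)
    else decide (∃ u ∈ W, col₀ u = rc (wpos W hg q.1 hi) ∧ G.Adj q.2 u)
  else
    if hj : q.2 ∈ W then decide (∃ u ∈ W, col₀ u = rc (wpos W hg q.2 hj) ∧ G.Adj q.1 u)
    else decide (G.Adj q.1 q.2)

variable {W hg G col₀ rc rb}

/-! ### The relabelling and soundness -/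

/-- **Soundness of the readout.** If `col₀` refines the signature colouring on `W` (`hsig`), and the rows are those of an enumeration `l` of `W`
(`rc k = col₀ (l k)`, `rb k k' = [l k ~ l k']`), then the graph of `outM` is the graph of `G` relabelled by a permutation `ρ` fixing every index
outside `W` (namely `ρ i = l (wpos i)` on `W`). [folklore] -/
theorem outM_sound (hsig : ∀ u ∈ W, ∀ v ∈ W, col₀ u = col₀ v → ∀ i, i ∉ W → (G.Adj i u ↔ G.Adj i v))
    (l : Fin g → Fin m) (hlinj : Function.Injective l) (hlW : ∀ k, l k ∈ W) (hrc : ∀ k, rc k = col₀ (l k))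
    (hrb : ∀ k k', rb k k' = decide (G.Adj (l k) (l k'))) :
    ∃ ρ : Equiv.Perm (Fin m), (∀ i, i ∉ W → ρ i = i) ∧ (∀ i (hi : i ∈ W), ρ i = l (wpos W hg i hi)) ∧
      (SimpleGraph.fromRel fun u v => outM W hg G col₀ rc rb (u, v) = true) = SimpleGraph.fromRel fun u v => G.Adj (ρ u) (ρ v) := by
  classical
  -- the piecewise map is injective, hence a permutation
  let f : Fin m → Fin m := fun i => if hi : i ∈ W then l (wpos W hg i hi) else i
  have hfW : ∀ i (hi : i ∈ W), f i = l (wpos W hg i hi) := fun i hi => dif_pos hi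
  have hfO : ∀ i, i ∉ W → f i = i := fun i hi => dif_neg hi
  have hfinj : Function.Injective f := by
    intro i j hij
    by_cases hi : i ∈ W <;> by_cases hj : j ∈ W
    · rw [hfW i hi, hfW j hj] at hij
      have h1 := hlinj hij
      exact wrank_injOn W hi hj (congrArg Fin.val h1)
    · rw [hfW i hi, hfO j hj] at hij
      exact absurd (hij ▸ hlW _) hj
    · rw [hfO i hi, hfW j hj] at hij
      exact absurd (hij ▸ hlW _ : i ∈ W) hi
    · rw [hfO i hi, hfO j hj] at hij
      exact hij
  let ρ : Equiv.Perm (Fin m) := Equiv.ofBijective f (Finite.injective_iff_bijective.1 hfinj)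
  have hρ : ∀ i, ρ i = f i := fun i => rfl
  refine ⟨ρ, fun i hi => (hρ i).trans (hfO i hi), fun i hi => (hρ i).trans (hfW i hi), ?_⟩
  -- entrywise comparison of the two symmetrised graphs
  have key : ∀ a b, a ≠ b → ((outM W hg G col₀ rc rb (a, b) = true ∨ outM W hg G col₀ rc rb (b, a) = true) ↔ G.Adj (f a) (f b)) := by
    intro a b hab
    -- window × ordered, in either orientation
    have hmixed : ∀ i j (hi : i ∈ W), j ∉ W → ((∃ u ∈ W, col₀ u = rc (wpos W hg i hi) ∧ G.Adj j u) ↔ G.Adj j (f i)) := by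
      intro i j hi hj
      rw [hfW i hi, hrc]
      constructor
      · rintro ⟨u, hu, hcu, hju⟩
        exact (hsig u hu _ (hlW _) hcu j hj).1 hju
      · intro h
        exact ⟨_, hlW _, rfl, h⟩
    by_cases ha : a ∈ W <;> by_cases hb : b ∈ W
    · -- window × window
      have h1 : outM W hg G col₀ rc rb (a, b) = decide (G.Adj (f a) (f b)) := by
        simp only [outM, ha, hb, dif_pos, hfW a ha, hfW b hb, hrb]
      have h2 : outM W hg G col₀ rc rb (b, a) = decide (G.Adj (f b) (f a)) := by
        simp only [outM, ha, hb, dif_pos, hfW a ha, hfW b hb, hrb]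
      rw [h1, h2, decide_eq_true_iff, decide_eq_true_iff, G.adj_comm (f b)]
      exact or_self_iff
    · have h1 : outM W hg G col₀ rc rb (a, b) = decide (∃ u ∈ W, col₀ u = rc (wpos W hg a ha) ∧ G.Adj b u) := by
        simp only [outM, ha, hb, dif_pos, dif_neg, not_false_eq_true]
      have h2 : outM W hg G col₀ rc rb (b, a) = decide (∃ u ∈ W, col₀ u = rc (wpos W hg a ha) ∧ G.Adj b u) := by
        simp only [outM, ha, hb, dif_pos, dif_neg, not_false_eq_true]
      rw [h1, h2, decide_eq_true_iff, or_self_iff, hmixed a b ha hb, hfO b hb, G.adj_comm]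
    · have h1 : outM W hg G col₀ rc rb (a, b) = decide (∃ u ∈ W, col₀ u = rc (wpos W hg b hb) ∧ G.Adj a u) := by
        simp only [outM, ha, hb, dif_pos, dif_neg, not_false_eq_true]
      have h2 : outM W hg G col₀ rc rb (b, a) = decide (∃ u ∈ W, col₀ u = rc (wpos W hg b hb) ∧ G.Adj a u) := by
        simp only [outM, ha, hb, dif_pos, dif_neg, not_false_eq_true]
      rw [h1, h2, decide_eq_true_iff, or_self_iff, hmixed b a hb ha, hfO a ha]
    · have h1 : outM W hg G col₀ rc rb (a, b) = decide (G.Adj a b) := by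
        simp only [outM, ha, hb, dif_neg, not_false_eq_true]
      have h2 : outM W hg G col₀ rc rb (b, a) = decide (G.Adj b a) := by
        simp only [outM, ha, hb, dif_neg, not_false_eq_true]
      rw [h1, h2, decide_eq_true_iff, decide_eq_true_iff, G.adj_comm b, or_self_iff, hfO a ha, hfO b hb]
  ext a b
  simp only [SimpleGraph.fromRel_adj, ne_eq]
  constructor
  · rintro ⟨hab, h⟩
    refine ⟨hab, ?_⟩
    rw [hρ a, hρ b]
    have := (key a b hab).1 h
    exact Or.inl this
  · rintro ⟨hab, h⟩
    refine ⟨hab, (key a b hab).2 ?_⟩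
    rw [hρ a, hρ b] at h
    rcases h with h | h
    · exact h
    · exact G.adj_symm h

/-- **The readout in the form of `GraphProgram.sound`** for the graph `Gr x = fromRel (x · = true)` of an input matrix and the window
`windowSet m`: the output graph is the graph of a `Bud(m,⌊log₂ m⌋)`-relabelling of the input matrix. [folklore] -/
theorem outM_sound_matrix (hW : W = windowSet m) (x : Fin m × Fin m → Bool)
    [DecidableRel (SimpleGraph.fromRel fun u v : Fin m => x (u, v) = true).Adj]
    (hsig : ∀ u ∈ W, ∀ v ∈ W, col₀ u = col₀ v → ∀ i, i ∉ W →
      ((SimpleGraph.fromRel fun u v : Fin m => x (u, v) = true).Adj i u ↔ (SimpleGraph.fromRel fun u v : Fin m => x (u, v) = true).Adj i v))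
    (l : Fin g → Fin m) (hlinj : Function.Injective l) (hlW : ∀ k, l k ∈ W) (hrc : ∀ k, rc k = col₀ (l k))
    (hrb : ∀ k k', rb k k' = decide ((SimpleGraph.fromRel fun u v : Fin m => x (u, v) = true).Adj (l k) (l k'))) :
    ∃ ρ ∈ pointStabiliserBudget m (Nat.log 2 m),
      (SimpleGraph.fromRel fun u v => outM W hg (SimpleGraph.fromRel fun u v : Fin m => x (u, v) = true) col₀ rc rb (u, v) = true) =
        SimpleGraph.fromRel fun u v => x (ρ u, ρ v) = true := by
  obtain ⟨ρ, hρO, -, hgr⟩ := outM_sound (W := W) (hg := hg) hsig l hlinj hlW hrc hrb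
  refine ⟨ρ, mem_budget_of_fix fun i hi => hρO i (hW ▸ hi), ?_⟩
  rw [hgr]
  ext a b
  simp only [SimpleGraph.fromRel_adj, ne_eq, EmbeddingLike.apply_eq_iff_eq]
  tauto

end GraphReadout

end Summit.PneNP.PneNP.Theorems
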